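import Literature.AlgebraicGeometry.ProjectiveSpace.PointsOnIrreducibleConicHilbertFunction
import HarnessLib

/-!
# Residuation of a plane point set with respect to an irreducible conic:
# `I(Z)_d = Q · I(Z ∖ Q)_{d−2}` when `Q` carries `≥ 2d + 1` points of `Z`, so
# `H_Z(d) = (2d + 1) + H_{Z ∖ Q}(d − 2)` (Eisenbud–Green–Harris 1996, proof of Prop. 1)

Topic `Literature/AlgebraicGeometry/ProjectiveSpace`, namespace
`Literature.AlgebraicGeometry.ProjectiveSpace`. Lane `lit-hodgefound`, seat `lit-hodgefound-p32`,
row gen26-#7. Theorems only (no definition, no named fact). `k` infinite (Bézout).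

## The source, as printed

D. Eisenbud, M. Green, J. Harris, *Cayley–Bacharach theorems and conjectures*, Bull. AMS 33 (1996),
§1.1, proof of Proposition 1 (p. 300): "If `d + 2` of the points of `Ω` lie on a line `L`, then by
Bézout's Theorem any curve of degree `d` containing `Ω` must contain `L`. The subset of curves of degree
`d` containing `L` has the same dimension as the set of curves of degree `d − 1`, so the codimension of
the set of curves containing `L` is only `d + 1` … A similar argument, using the fact that it is only
`2d + 1` conditions to contain an irreducible conic, works in the second case"; (p. 300) "By Bézout's
Theorem, if `Γ'` lay on a conic `C`, then both `X_1` and `X_2` would have to contain (a component of)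
`C`".

## Dictionary

As in `ProjectiveSpace/PointsOnIrreducibleConicHilbertFunction` (which treats the case `Z ⊆ Q`):
`Z = {P_j}_{j ∈ ι}` non-zero pairwise non-proportional vectors of `k³`, `I(Z) = projVanishingIdeal`,
`H_Z(d) = dim S_d − dim I(Z)_d`; `Q` an IRREDUCIBLE form of degree `2`; the residual point set
`Z ∖ Q = {P_j : Q(P_j) ≠ 0}` has ideal `projVanishingIdeal (P '' {j | Q(P_j) ≠ 0})`. The companion file
`LineResidualHilbertFunction` is the case of a line.

## What is here (all `theorem`s)

* § 1 `dvd_of_irreducible_conic_of_card_le` — Bézout / Harris Ex. 1.15 for a finite subset: a form of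
  degree `d` vanishing at `≥ 2d + 1` distinct points of the irreducible conic `Q` is divisible by `Q`
  (`PointsOnIrreducibleConicHilbertFunction.dvd_of_irreducible_conic` on the subfamily).
* § 2 **`idealDegree_projVanishingIdeal_eq_map_mulLeft_of_conic`** — if `≥ 2t + 5` points of `Z` lie
  on `Q`, then `I(Z)_{t+2} = Q · I(Z ∖ Q)_t` ("any curve of degree `d` containing `Ω` must contain
  `C`; the curves containing `C` ↔ the curves of degree `d − 2`"), and
  **`hilbert_projVanishingIdeal_eq_add_of_conic`**: `H_Z(t + 2) = (2t + 5) + H_{Z ∖ Q}(t)` — "it is only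
  `2d + 1` conditions to contain an irreducible conic", the remaining conditions being those of the
  residual points on curves of degree `d − 2`.
* § 3 **`hilbert_projVanishingIdeal_eq_card_iff_residual_conic`**: with `≥ 2d + 1` points on `Q`
  (`d = t + 2`), `Z` imposes independent conditions on curves of degree `d` iff exactly `2d + 1` of its
  points lie on `Q` and `Z ∖ Q` imposes independent conditions on curves of degree `d − 2`.

## References

* [EisenbudGreenHarris1996] D. Eisenbud, M. Green, J. Harris, *Cayley–Bacharach theorems and
  conjectures*, Bull. Amer. Math. Soc. 33 (1996), §1.1, Prop. 1 and its proof (p. 300).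
* [Harris1992] J. Harris, *Algebraic Geometry: A First Course*, GTM 133, Springer 1992, Exercise 1.15
  (p. 11) (via `PointsOnIrreducibleConicHilbertFunction`).
-/

noncomputable section

open MvPolynomial Module
open Literature.RingTheory.MvPolynomial

universe u

namespace Literature.AlgebraicGeometry.ProjectiveSpace

variable {k : Type u} [Field k] [Infinite k] {ι : Type*}

/-! ### § 1 Bézout for an irreducible conic and a finite subset -/

/-- **A form of degree `d` through `≥ 2d + 1` distinct points of an irreducible conic `Q` is divisible by
`Q`** (finite-subset form of `dvd_of_irreducible_conic`; `k` infinite).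
[cite: EisenbudGreenHarris1996, §1.1, proof of Prop. 1 (p. 300)] [cite: Harris1992, Exercise 1.15 (p. 11)] -/
theorem dvd_of_irreducible_conic_of_card_le {Q : MvPolynomial (Fin 3) k} (hQ : Q.IsHomogeneous 2)
    (hirr : Irreducible Q) (P : ι → Fin 3 → k) (h0 : ∀ i, P i ≠ 0)
    (hP : Pairwise fun i j => P i ∉ (k ∙ P j : Submodule k (Fin 3 → k))) (s : Finset ι)
    (hs : ∀ j ∈ s, MvPolynomial.eval (P j) Q = 0) {F : MvPolynomial (Fin 3) k} {d : ℕ}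
    (hF : F.IsHomogeneous d) (hcard : 2 * d + 1 ≤ s.card) (hFs : ∀ j ∈ s, MvPolynomial.eval (P j) F = 0) :
    Q ∣ F := by
  classical
  exact dvd_of_irreducible_conic hQ hirr (fun j : s => P j) (fun j => h0 j)
    (fun i j hij => hP fun h => hij (Subtype.ext h)) (fun j => hs j j.2)
    (by rwa [Fintype.card_coe]) hF (fun j => hFs j j.2)

/-! ### § 2 `I(Z)_{t+2} = Q · I(Z ∖ Q)_t` and `H_Z(t + 2) = (2t + 5) + H_{Z ∖ Q}(t)` -/

/-- **Residuation with respect to an irreducible conic: `I(Z)_{t+2} = Q · I(Z ∖ Q)_t` when at least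
`2(t + 2) + 1` points of `Z` lie on `Q`.** A form of degree `t + 2` through `Z` is `Q · G` (Bézout) with
`G` of degree `t` through the points of `Z` off `Q`; conversely such products vanish on `Z` ("any curve
of degree `d` containing `Ω` must contain `C`"; `k` infinite).
[cite: EisenbudGreenHarris1996, §1.1, proof of Prop. 1 (p. 300)] -/
theorem idealDegree_projVanishingIdeal_eq_map_mulLeft_of_conic {Q : MvPolynomial (Fin 3) k}
    (hQ : Q.IsHomogeneous 2) (hirr : Irreducible Q) (P : ι → Fin 3 → k) (h0 : ∀ i, P i ≠ 0)
    (hP : Pairwise fun i j => P i ∉ (k ∙ P j : Submodule k (Fin 3 → k))) (s : Finset ι)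
    (hs : ∀ j ∈ s, MvPolynomial.eval (P j) Q = 0) {t : ℕ} (hcard : 2 * (t + 2) + 1 ≤ s.card) :
    idealDegree (projVanishingIdeal (Set.range P)) (t + 2) =
      (idealDegree (projVanishingIdeal (P '' {j | MvPolynomial.eval (P j) Q ≠ 0})) t).map
        (LinearMap.mulLeft k Q) := by
  apply le_antisymm
  · intro F hF
    rw [mem_idealDegree] at hF
    have hFZ : ∀ j, MvPolynomial.eval (P j) F = 0 := fun j =>
      (mem_projVanishingIdeal_iff_of_isHomogeneous hF.2).mp hF.1 _ ⟨j, rfl⟩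
    obtain ⟨G, hG⟩ := dvd_of_irreducible_conic_of_card_le hQ hirr P h0 hP s hs hF.2 hcard fun j _ => hFZ j
    have hFeq : F = Q * homogeneousComponent t G := by
      rw [← homogeneousComponent_mul_add_of_isHomogeneous hQ G t, ← hG, homogeneousComponent_eq_self hF.2]
    refine ⟨homogeneousComponent t G, mem_idealDegree.mpr ⟨?_, homogeneousComponent_isHomogeneous t G⟩,
      by rw [LinearMap.mulLeft_apply, ← hFeq]⟩
    refine mem_projVanishingIdeal_of_isHomogeneous (homogeneousComponent_isHomogeneous t G) ?_
    rintro _ ⟨j, hj, rfl⟩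
    have h2 := hFZ j
    rw [hFeq, map_mul, mul_eq_zero] at h2
    exact h2.resolve_left hj
  · rintro _ ⟨G, hG, rfl⟩
    rw [SetLike.mem_coe, mem_idealDegree] at hG
    have hdeg : (Q * G).IsHomogeneous (t + 2) := by
      have h := hQ.mul hG.2
      rwa [add_comm] at h
    have hQI : Q ∈ projVanishingIdeal (P '' {j | MvPolynomial.eval (P j) Q = 0}) :=
      mem_projVanishingIdeal_of_isHomogeneous hQ (by rintro _ ⟨j, hj, rfl⟩; exact hj)
    refine mem_idealDegree.mpr ⟨mem_projVanishingIdeal_of_isHomogeneous hdeg ?_, hdeg⟩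
    rintro _ ⟨j, rfl⟩
    rw [LinearMap.mulLeft_apply, map_mul]
    by_cases hj : MvPolynomial.eval (P j) Q = 0
    · rw [hj, zero_mul]
    · rw [(mem_projVanishingIdeal_iff_of_isHomogeneous hG.2).mp hG.1 _ ⟨j, hj, rfl⟩, mul_zero]

/-- `dim_k I(Z)_{t+2} = dim_k I(Z ∖ Q)_t` under the same hypothesis (multiplication by `Q` is
injective). [cite: EisenbudGreenHarris1996, §1.1, proof of Prop. 1 (p. 300)] -/
theorem finrank_idealDegree_projVanishingIdeal_eq_of_conic {Q : MvPolynomial (Fin 3) k}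
    (hQ : Q.IsHomogeneous 2) (hirr : Irreducible Q) (P : ι → Fin 3 → k) (h0 : ∀ i, P i ≠ 0)
    (hP : Pairwise fun i j => P i ∉ (k ∙ P j : Submodule k (Fin 3 → k))) (s : Finset ι)
    (hs : ∀ j ∈ s, MvPolynomial.eval (P j) Q = 0) {t : ℕ} (hcard : 2 * (t + 2) + 1 ≤ s.card) :
    finrank k (idealDegree (projVanishingIdeal (Set.range P)) (t + 2)) =
      finrank k (idealDegree (projVanishingIdeal (P '' {j | MvPolynomial.eval (P j) Q ≠ 0})) t) := by
  rw [idealDegree_projVanishingIdeal_eq_map_mulLeft_of_conic hQ hirr P h0 hP s hs hcard,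
    finrank_map_mulLeft hirr.ne_zero]

/-- **"It is only `2d + 1` conditions to contain an irreducible conic": `H_Z(t + 2) = (2t + 5) + H_{Z ∖ Q}(t)`**
when at least `2t + 5` points of `Z` lie on the irreducible conic `Q` — `dim S_{t+2} − dim S_t = 2t + 5`
conditions to contain `Q`, the rest being the conditions imposed by the residual points on curves of
degree `t` (`k` infinite). [cite: EisenbudGreenHarris1996, §1.1, proof of Prop. 1 (p. 300)] -/
theorem hilbert_projVanishingIdeal_eq_add_of_conic {Q : MvPolynomial (Fin 3) k}
    (hQ : Q.IsHomogeneous 2) (hirr : Irreducible Q) (P : ι → Fin 3 → k) (h0 : ∀ i, P i ≠ 0)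
    (hP : Pairwise fun i j => P i ∉ (k ∙ P j : Submodule k (Fin 3 → k))) (s : Finset ι)
    (hs : ∀ j ∈ s, MvPolynomial.eval (P j) Q = 0) {t : ℕ} (hcard : 2 * (t + 2) + 1 ≤ s.card) :
    finrank k (homogeneousSubmodule (Fin 3) k (t + 2)) -
        finrank k (idealDegree (projVanishingIdeal (Set.range P)) (t + 2)) =
      (2 * t + 5) + (finrank k (homogeneousSubmodule (Fin 3) k t) -
        finrank k (idealDegree (projVanishingIdeal (P '' {j | MvPolynomial.eval (P j) Q ≠ 0})) t)) := by
  rw [finrank_idealDegree_projVanishingIdeal_eq_of_conic hQ hirr P h0 hP s hs hcard,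
    finrank_homogeneousSubmodule_fin_three, finrank_homogeneousSubmodule_fin_three]
  have hle := finrank_idealDegree_le (projVanishingIdeal (P '' {j | MvPolynomial.eval (P j) Q ≠ 0})) t
  rw [finrank_homogeneousSubmodule_fin_three] at hle
  have h1 : (t + 2 + 2).choose 2 = (t + 3) + ((t + 2) + (t + 2).choose 2) := by
    rw [show t + 2 + 2 = (t + 3) + 1 by omega, Nat.choose_succ_succ' (t + 3) 1, Nat.choose_one_right,
      show t + 3 = (t + 2) + 1 by omega, Nat.choose_succ_succ' (t + 2) 1, Nat.choose_one_right]
  omega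

/-! ### § 3 Independent conditions and the residual set -/

/-- **With `≥ 2d + 1` points on an irreducible conic** (`d = t + 2`, `Z ∖ Q = {P_j}_{j ∉ s}`): `Z`
imposes independent conditions on curves of degree `d` iff exactly `2d + 1` of its points lie on `Q`
and `Z ∖ Q` imposes independent conditions on curves of degree `d − 2` (from
`H_Z(d) = (2d + 1) + H_{Z ∖ Q}(d − 2)` and `H_{Z ∖ Q}(d − 2) ≤ #(Z ∖ Q)`; `k` infinite).
[cite: EisenbudGreenHarris1996, §1.1, Prop. 1 and its proof (p. 300)] -/
theorem hilbert_projVanishingIdeal_eq_card_iff_residual_conic [Fintype ι] [DecidableEq ι]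
    {Q : MvPolynomial (Fin 3) k} (hQ : Q.IsHomogeneous 2) (hirr : Irreducible Q) (P : ι → Fin 3 → k)
    (h0 : ∀ i, P i ≠ 0) (hP : Pairwise fun i j => P i ∉ (k ∙ P j : Submodule k (Fin 3 → k)))
    (s : Finset ι) (hs : ∀ j, j ∈ s ↔ MvPolynomial.eval (P j) Q = 0) {t : ℕ}
    (hcard : 2 * (t + 2) + 1 ≤ s.card) :
    finrank k (homogeneousSubmodule (Fin 3) k (t + 2)) -
        finrank k (idealDegree (projVanishingIdeal (Set.range P)) (t + 2)) = Fintype.card ι ↔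
      s.card = 2 * (t + 2) + 1 ∧
        finrank k (homogeneousSubmodule (Fin 3) k t) -
          finrank k (idealDegree (projVanishingIdeal (Set.range fun j : ↥(sᶜ) => P j)) t) = sᶜ.card := by
  have hrange : Set.range (fun j : ↥(sᶜ) => P j) = P '' {j | MvPolynomial.eval (P j) Q ≠ 0} := by
    ext x
    constructor
    · rintro ⟨⟨j, hj⟩, rfl⟩
      exact ⟨j, fun h => (Finset.mem_compl.mp hj) ((hs j).mpr h), rfl⟩
    · rintro ⟨j, hj, rfl⟩
      exact ⟨⟨j, Finset.mem_compl.mpr fun h => hj ((hs j).mp h)⟩, rfl⟩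
  have hH := hilbert_projVanishingIdeal_eq_add_of_conic hQ hirr P h0 hP s (fun j hj => (hs j).mp hj) hcard
  have hle := hilbert_projVanishingIdeal_le_card (fun j : ↥(sᶜ) => P j) t
  rw [Fintype.card_coe, hrange] at hle
  have hc : sᶜ.card = Fintype.card ι - s.card := Finset.card_compl s
  have hsle : s.card ≤ Fintype.card ι := Finset.card_le_univ s
  rw [hrange, hH]
  omega

end Literature.AlgebraicGeometry.ProjectiveSpace

end
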